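import Summits.QuantumFields.BalabanUV.T4Continuum.Spine.NE3.EndLinesNonVacuous
import Summits.QuantumFields.BalabanUV.T4Continuum.Spine.NE3.LandauCorrectionSupB8Flat
import HarnessLib

/-!
# T⁴ programme, node NE3 — census R34: THE END WITH THE SUP LETTER `hK` DISPLAYED AS ITS [B9] CONTENT — NE3's local half over Bałaban's class
# ⇐ `PairLandauGaugeB8Avg` ([B8] Thm 2 + (1.37) ∘ [B11] Thm 1 TYPE) ∧ per pair {(H0_W) sup-regularity of `Δ_W` on `N(Q′(W))` ((3.42) e0∕e1 TYPE),
# (HR_W) `‖R(W)‖_∞ ≤ c_R` ((3.25)∕(3.49) TYPE)} ∧ per pair (P♮) on `slicB8` ([B9] Thm 3.3 TYPE), for all sufficiently small `(ε, s₁)`, `b ≤ ε∕2`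

Cell `pub-balaban-gaps` (YM blitz, track G2, seat `ne3`, unit `pub-balaban-gaps-ne3`; writer prover-pub-balaban-gaps-ne3-g7-0, 2026-08-24), census
`run/shared/lean/pub/pub-balaban-gaps/ne/NE3.md` §4 R34, §13.  WHY.  `EndLinesNonVacuous.ne3EnergyRateWCov_sfClass_small` (gen 5, p360570 ✓) displays NE3's local half
over `sfClass` as ONE implication from three printed TYPES, the middle one being the opaque per-pair shape `LandauProjectionSupShape.LandauCorrectionSupB8 … K₀ K₁`
([B9] (3.42)∕(3.48) «read for the lineage's lift»).  Gen 7's `LandauCorrectionSupB8Flat.landauCorrectionSupB8_of_supFacts` (p380184 ✓ + §5 append) shows that shape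
follows, at every unitary periodic background `W` of the class, from two solution-form sup-norm facts about the covariant site Laplacian `Δ_W = covLapSite W` on B8's
test space `N(Q′(W)) = avgKernelGauges L N (j+1) W`, with `K₀ = d·liftC·(6 + 2(d+1)ε)·c₀c_R∕(1 − cruxC·ε)`, `K₁` likewise (`x = ε∕M²` at level `j`, so `M²x = ε`,
`θ = cruxC·ε` — level-free).  THIS FILE plugs it in: **`ne3EnergyRateWCov_sfClass_small_of_supFacts`** — the same END with the `hK` binder REPLACED by the per-pair
conjunction (H0_W) ∧ (HR_W) with uniform constants `c₀, c₁, c_R ≥ 0`; the radius `r` is that of the gen-5 END at `K₀* = 2d·liftC·(8 + 2d)·c₀c_R`,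
`K₁* = 2d·liftC·(8 + 2d)·c₁c_R`, shrunk to `r ≤ 1∕(2·cruxC + 2)` so that `ε ≤ 1` and `cruxC·ε ≤ ½` make `K₀(ε) ≤ K₀*`, `K₁(ε) ≤ K₁*` (`LandauCorrectionSupB8.mono`);
the background's periodicity comes from `Regular.periodic` through `AveragingDeficitFermat.isPeriodicCfg_cavg`.

WHAT THE DISPLAYED FACTS ARE.  (H0_W): `∀ u ∈ N(Q′(W)), ‖Δ_Wu‖_∞ ≤ B ⟹ ‖u‖_∞ ≤ c₀M²B ∧ ‖D_Wu‖_∞ ≤ c₁MB` — the entries `|G(U₀)λ| ≤ O(1)(L^jη)²|λ|`,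
`|∇_{U₀}G(U₀)λ| ≤ O(1)(L^jη)|λ|` of [Balaban1985BackgroundPropagators] Thm 3.1∕3.3 (3.42) (at `U₀ = 1`: [Balaban1984PropagatorsII] (2.67)), read on `Δ_WN(Q′(W))`, TYPE;
(HR_W): `F + Δ_Wμ ⊥_{hsR} Δ_WN(Q′(W))`, `μ ∈ N(Q′(W))`, `‖F‖_∞ ≤ B` ⟹ `‖Δ_Wμ‖_∞ ≤ c_R B` — the `ℓ^∞` bound of B8's projection `R(U₀)` (p. 80), i.e. of `I − P` with
[Balaban1985BackgroundPropagators] (3.25)∕(3.49), TYPE.  Both are KERNEL-CHECKED at `U = 1` in the Literature on its own torus carriers (finding F12, census §13) and are NOT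
proved here for any background.

CONTENT (0 sorry; no `def`): §1 `cruxC_eps_le_half` (the shrink line), `supFacts_const_le` (the `K(ε) ≤ K*` arithmetic); §2 **`ne3EnergyRateWCov_sfClass_small_of_supFacts`**.

HONEST FRAMING.  A re-plumbing of the gen-5 END: one hypothesis SHAPE replaced by two displayed printed-TYPE facts per pair; (H0_W), (HR_W), (P♮), `PairLandauGaugeB8Avg` are
NOT proved; **NE3 is NOT proved**; spine PROVED 0∕9; finite T⁴ rung (B)+1 — NOT infinite volume, NOT mass gap, NOT `BetaPertH`, NOT Clay.  PLACEMENT: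
`Summits/QuantumFields/BalabanUV/T4Continuum/Spine/NE3/`; imports accepted modules only; moves nothing.  HONEST DEPENDENCY (cell page 1): continuum YM on T⁴ ⇐ BetaPertH ∧ nine
spine estimates (0/9 proved); BetaPertH ⇐ (D1) ∧ (D4) ∧ CAP+tail; G-an2-4 gates asym, D1 and NE2/3/4.
-/

set_option autoImplicit false

open scoped BigOperators Matrix Matrix.Norms.L2Operator
open NormedSpace Finset

namespace Summit.QuantumFields.BalabanUV.T4Continuum.NE3.PairLandauB8EndSupFacts

open Literature.MathematicalPhysics.QuantumFieldTheory.Balaban1983to89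
open B7Prop1Explicit B7Prop2Explicit
open T4AveragingDeficitWall (IsSkewDir IsUnitaryCfg SmallField)
open T4AveragingDeficitWallBoundary (IsPeriodicCfg periodBox)
open AveragingDeficitChartCalculus (cavg)
open AveragingDeficitFermat (isPeriodicCfg_cavg)
open AveragingDeficitMultiLevelPrep (LevelSmall)
open BlockAveragePushDirGauge (gaugeDir)
open MinimalActionSandwich (IsMinimiser)
open MinimalActionRate (Regular sfClass)
open NE3EnergyWeightedCovShape (NE3EnergyRateWCov)
open NE3SlicePoincareShape (SlicePoincare)
open NE3QbarIterCovLiftPrep (cruxC liftC liftC_nonneg)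
open NE3RightInverseSolveLetters (cruxC_nonneg)
open NE3CovariantCalculus (hsR)
open NE3.PairLandauB8 (avgKernelGauges covLapSite)
open NE3.PairLandauB8Avg (PairLandauGaugeB8Avg slicB8)
open NE3.LandauProjectionSupShape (LandauCorrectionSupB8)
open NE3.EndLinesNonVacuous (ne3EnergyRateWCov_sfClass_small)
open NE3.LandauCorrectionSupB8Flat (landauCorrectionSupB8_of_supFacts)

noncomputable section

variable {n : Type*} [Fintype n] [DecidableEq n]

/-! ## §1 The shrink line and the constant arithmetic -/

/-- For `ε ≤ 1∕(2·cruxC + 2)`: `cruxC·ε ≤ ½` and `ε ≤ 1`. [folklore] -/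
theorem cruxC_eps_le_half (d L : ℕ) {ε : ℝ} (hε : 0 ≤ ε) (hεr : ε ≤ 1 / (2 * cruxC d L + 2)) :
    cruxC d L * ε ≤ 1 / 2 ∧ ε ≤ 1 := by
  have hc := cruxC_nonneg d L
  have hpos : 0 < 2 * cruxC d L + 2 := by positivity
  have h1 : ε * (2 * cruxC d L + 2) ≤ 1 := by
    have := mul_le_mul_of_nonneg_right hεr hpos.le
    rwa [div_mul_cancel₀ _ hpos.ne'] at this
  constructor
  · nlinarith
  · nlinarith

/-- The constant arithmetic: for `A ≥ 0`, `0 ≤ ε ≤ 1`, `cruxC·ε ≤ ½`:  `A·(6 + 2(d+1)·ε)∕(1 − cruxC·ε) ≤ 2·A·(6 + 2(d+1))`. [folklore] -/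
theorem supFacts_const_le (d L : ℕ) {A ε : ℝ} (hA : 0 ≤ A) (hε : 0 ≤ ε) (hε1 : ε ≤ 1) (hc : cruxC d L * ε ≤ 1 / 2) :
    A * (6 + 2 * ((d : ℝ) + 1) * ε) / (1 - cruxC d L * ε) ≤ 2 * (A * (6 + 2 * ((d : ℝ) + 1))) := by
  have hden : 1 / 2 ≤ 1 - cruxC d L * ε := by linarith
  have hX0 : 0 ≤ A * (6 + 2 * ((d : ℝ) + 1) * ε) := by positivity
  have hnum : A * (6 + 2 * ((d : ℝ) + 1) * ε) ≤ A * (6 + 2 * ((d : ℝ) + 1)) := by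
    apply mul_le_mul_of_nonneg_left _ hA
    nlinarith
  calc A * (6 + 2 * ((d : ℝ) + 1) * ε) / (1 - cruxC d L * ε)
      ≤ A * (6 + 2 * ((d : ℝ) + 1) * ε) / (1 / 2) := div_le_div_of_nonneg_left hX0 (by norm_num) hden
    _ = 2 * (A * (6 + 2 * ((d : ℝ) + 1) * ε)) := by ring
    _ ≤ 2 * (A * (6 + 2 * ((d : ℝ) + 1))) := by linarith

/-! ## §2 The END with `hK` displayed as (H0_W) ∧ (HR_W) -/

/-- **NE3's LOCAL HALF OVER BAŁABAN's CLASS WITH THE SUP LETTER DISPLAYED AS ITS [B9] CONTENT** (`3 ≤ d`, `2 ≤ L`, `1 ≤ N`, `g > 0`, `CP, c₀, c₁, c_R ≥ 0`): there is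
`r > 0` such that for all `0 < ε ≤ r`, `0 ≤ s₁ ≤ r`, `0 ≤ b ≤ ε∕2`:
`PairLandauGaugeB8Avg d (sfClass d L N ε) L N b g s₁ s₂ 1 dom` ([B8] Thm 2 + (1.37) ∘ [B11] Thm 1 TYPE)
∧ per pair `(V, U_B)` (minimiser at level `j+2`, `(b, g)`-regular), at the background `W = cavg L U_B`, `M = L^{j+1}`:
  (H0_W) `∀ u ∈ N(Q′(W)), (∀ y, ‖Δ_W u y‖ ≤ B) → (∀ y, ‖u y‖ ≤ c₀M²B) ∧ (∀ y μ, ‖D_W u (y, μ)‖ ≤ c₁MB)`   ([B9] (3.42) entries e0∕e1 on `Δ_WN(Q′(W))`, TYPE)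
  (HR_W) `∀ F skew (N·M)-periodic, ∀ μ ∈ N(Q′(W)), (F + Δ_Wμ ⊥_{hsR} Δ_WN(Q′(W)) over the period box) → (∀ y, ‖F y‖ ≤ B) → ∀ y, ‖Δ_Wμ y‖ ≤ c_R B`   ((3.25)∕(3.49), TYPE)
∧ per pair `(P♮)` on `slicB8` with constant `CP` ([B9] Thm 3.3 TYPE)
⟹ `∃ C, NE3EnergyRateWCov d (sfClass d L N ε) L N b g C s₁ s₂ dom` (the covariant root NE7 consumes).
= `EndLinesNonVacuous.ne3EnergyRateWCov_sfClass_small` at `K₀* = 2d·liftC·(8+2d)·c₀c_R`, `K₁* = 2d·liftC·(8+2d)·c₁c_R` ∘ `LandauCorrectionSupB8Flat.landauCorrectionSupB8_of_supFacts`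
∘ `LandauCorrectionSupB8.mono`, with `r` shrunk below `1∕(2·cruxC + 2)`. [folklore] -/
theorem ne3EnergyRateWCov_sfClass_small_of_supFacts [Nonempty n] {d : ℕ} (hd : 3 ≤ d) {L N : ℕ} [NeZero L] [NeZero N] (hL : 2 ≤ L) (hN : 1 ≤ N)
    {g CP c₀ c₁ cR : ℝ} (hg : 0 < g) (hCP : 0 ≤ CP) (hc₀ : 0 ≤ c₀) (hc₁ : 0 ≤ c₁) (hcR : 0 ≤ cR) :
    ∃ r : ℝ, 0 < r ∧ ∀ ⦃ε s₁ b : ℝ⦄, 0 < ε → ε ≤ r → 0 ≤ s₁ → s₁ ≤ r → 0 ≤ b → b ≤ ε / 2 →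
      ∀ (s₂ : ℝ) {dom : _root_.Set (Site d → Fin d → (Matrix n n ℂ)ˣ)},
        PairLandauGaugeB8Avg d (sfClass d L N ε) L N b g s₁ s₂ 1 dom →
        (∀ j : ℕ, ∀ V ∈ dom, ∀ UB : Site d → Fin d → (Matrix n n ℂ)ˣ, IsMinimiser d (sfClass d L N ε) L N (j + 2) V UB → Regular d L N b g (j + 2) UB →
          (∀ u ∈ avgKernelGauges (d := d) (n := n) L N (j + 1) (cavg L UB), ∀ B : ℝ, (∀ y : Site d, ‖covLapSite (cavg L UB) u y‖ ≤ B) →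
              (∀ y : Site d, ‖u y‖ ≤ c₀ * ((L : ℝ) ^ (j + 1)) ^ 2 * B) ∧
              (∀ (y : Site d) (μ : Fin d), ‖gaugeDir (cavg L UB) u y μ‖ ≤ c₁ * (L : ℝ) ^ (j + 1) * B)) ∧
          (∀ (F : Site d → Matrix n n ℂ), (∀ y : Site d, F y ∈ skewAdjoint (Matrix n n ℂ)) →
            (∀ (y : Site d) (i : Fin d), F (y + ((N * L ^ (j + 1) : ℕ) : ℤ) • e i) = F y) →
            ∀ μ ∈ avgKernelGauges (d := d) (n := n) L N (j + 1) (cavg L UB),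
              (∀ ν ∈ avgKernelGauges (d := d) (n := n) L N (j + 1) (cavg L UB),
                ∑ y ∈ periodBox (d := d) (N * L ^ (j + 1)), hsR (F y + covLapSite (cavg L UB) μ y) (covLapSite (cavg L UB) ν y) = 0) →
              ∀ B : ℝ, (∀ y : Site d, ‖F y‖ ≤ B) → ∀ y : Site d, ‖covLapSite (cavg L UB) μ y‖ ≤ cR * B)) →
        (∀ j : ℕ, ∀ V ∈ dom, ∀ UB : Site d → Fin d → (Matrix n n ℂ)ˣ, IsMinimiser d (sfClass d L N ε) L N (j + 2) V UB → Regular d L N b g (j + 2) UB →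
          SlicePoincare L (j + 1) (cavg L UB) (slicB8 L N (j + 1) (cavg L UB)) CP (periodBox (N * L ^ (j + 1)))) →
        ∃ C : ℝ, NE3EnergyRateWCov d (sfClass d L N ε) L N b g C s₁ s₂ dom := by
  -- the uniform majorants of the reduction's constants (named by `obtain … rfl`, no goal rewriting)
  obtain ⟨K₀s, hK₀s⟩ : ∃ K : ℝ, K = 2 * ((d : ℝ) * liftC d * c₀ * cR * (6 + 2 * ((d : ℝ) + 1))) := ⟨_, rfl⟩
  obtain ⟨K₁s, hK₁s⟩ : ∃ K : ℝ, K = 2 * ((d : ℝ) * liftC d * c₁ * cR * (6 + 2 * ((d : ℝ) + 1))) := ⟨_, rfl⟩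
  have hK₀ : 0 ≤ K₀s := by rw [hK₀s]; have := liftC_nonneg d; positivity
  have hK₁ : 0 ≤ K₁s := by rw [hK₁s]; have := liftC_nonneg d; positivity
  obtain ⟨r, hr0, hr⟩ := ne3EnergyRateWCov_sfClass_small (n := n) hd hL hN (CP := CP) hg hCP hK₀ hK₁
  have hc := cruxC_nonneg d L
  have hρ0 : 0 < 1 / (2 * cruxC d L + 2) := by positivity
  refine ⟨min r (1 / (2 * cruxC d L + 2)), lt_min hr0 hρ0, fun ε s₁ b hε hεr hs₁ hs₁r hb hbh s₂ dom hB8 hSUP hP => ?_⟩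
  have hεr' : ε ≤ r := hεr.trans (min_le_left _ _)
  have hs₁r' : s₁ ≤ r := hs₁r.trans (min_le_left _ _)
  obtain ⟨hcε, hε1⟩ := cruxC_eps_le_half d L hε.le (hεr.trans (min_le_right _ _))
  have hL1 : 1 ≤ L := by omega
  -- the `hK` binder of the gen-5 END, from (H0_W) ∧ (HR_W) per pair through the reduction and `mono`
  have hF5 : ∀ j : ℕ, ∀ V ∈ dom, ∀ UB : Site d → Fin d → (Matrix n n ℂ)ˣ, IsMinimiser d (sfClass d L N ε) L N (j + 2) V UB →
      Regular d L N b g (j + 2) UB → ∀ (hWu : IsUnitaryCfg (cavg L UB)) (hx : 0 ≤ ε / ((L : ℝ) ^ (j + 1)) ^ 2)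
      (hs : LevelSmall d L j (ε / ((L : ℝ) ^ (j + 1)) ^ 2)) (hWx : SmallField (cavg L UB) (ε / ((L : ℝ) ^ (j + 1)) ^ 2))
      (hθ : cruxC d L * (((L : ℝ) ^ (j + 1)) ^ 2 * (ε / ((L : ℝ) ^ (j + 1)) ^ 2)) < 1), LandauCorrectionSupB8 hL j hWu hx hs hWx N hθ K₀s K₁s := by
    intro j V hV UB hmin hreg hWu hx hs hWx hθ
    obtain ⟨hG, hR⟩ := hSUP j V hV UB hmin hreg
    have hM0 : (0 : ℝ) < (L : ℝ) ^ (j + 1) := by positivity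
    -- the background is `(N·L^{j+1})`-periodic
    have hWP : IsPeriodicCfg (cavg L UB) ((N * L ^ (j + 1) : ℕ) : ℤ) := by
      have hUP := hreg.periodic
      have e : ((N * L ^ (j + 2) : ℕ) : ℤ) = (L : ℤ) * ((N * L ^ (j + 1) : ℕ) : ℤ) := by push_cast; ring
      rw [e] at hUP
      exact isPeriodicCfg_cavg L (N * L ^ (j + 1)) hUP
    have h := landauCorrectionSupB8_of_supFacts hL j hWu hx hs hWx N hθ hWP hG hR
    have ht : ((L : ℝ) ^ (j + 1)) ^ 2 * (ε / ((L : ℝ) ^ (j + 1)) ^ 2) = ε := by field_simp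
    -- the two constant inequalities `K(ε) ≤ K*`, stated on the reduction's literal expressions
    have hle₀ : (d : ℝ) * liftC d * (6 + 2 * ((d : ℝ) + 1) * (((L : ℝ) ^ (j + 1)) ^ 2 * (ε / ((L : ℝ) ^ (j + 1)) ^ 2))) * c₀ * cR
          / (1 - cruxC d L * (((L : ℝ) ^ (j + 1)) ^ 2 * (ε / ((L : ℝ) ^ (j + 1)) ^ 2))) ≤ K₀s := by
      rw [ht, hK₀s]
      have hA : 0 ≤ (d : ℝ) * liftC d * c₀ * cR := by have := liftC_nonneg d; positivity
      have key := supFacts_const_le d L hA hε.le hε1 hcε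
      calc (d : ℝ) * liftC d * (6 + 2 * ((d : ℝ) + 1) * ε) * c₀ * cR / (1 - cruxC d L * ε)
          = (d : ℝ) * liftC d * c₀ * cR * (6 + 2 * ((d : ℝ) + 1) * ε) / (1 - cruxC d L * ε) := by ring
        _ ≤ 2 * ((d : ℝ) * liftC d * c₀ * cR * (6 + 2 * ((d : ℝ) + 1))) := key
    have hle₁ : (d : ℝ) * liftC d * (6 + 2 * ((d : ℝ) + 1) * (((L : ℝ) ^ (j + 1)) ^ 2 * (ε / ((L : ℝ) ^ (j + 1)) ^ 2))) * c₁ * cR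
          / (1 - cruxC d L * (((L : ℝ) ^ (j + 1)) ^ 2 * (ε / ((L : ℝ) ^ (j + 1)) ^ 2))) ≤ K₁s := by
      rw [ht, hK₁s]
      have hA : 0 ≤ (d : ℝ) * liftC d * c₁ * cR := by have := liftC_nonneg d; positivity
      have key := supFacts_const_le d L hA hε.le hε1 hcε
      calc (d : ℝ) * liftC d * (6 + 2 * ((d : ℝ) + 1) * ε) * c₁ * cR / (1 - cruxC d L * ε)
          = (d : ℝ) * liftC d * c₁ * cR * (6 + 2 * ((d : ℝ) + 1) * ε) / (1 - cruxC d L * ε) := by ring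
        _ ≤ 2 * ((d : ℝ) * liftC d * c₁ * cR * (6 + 2 * ((d : ℝ) + 1))) := key
    exact LandauCorrectionSupB8.mono hL j hWu hx hs hWx N hθ h hle₀ hle₁
  exact hr hε hεr' hs₁ hs₁r' hb hbh s₂ hB8 hF5 hP

end

end Summit.QuantumFields.BalabanUV.T4Continuum.NE3.PairLandauB8EndSupFacts
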